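import Literature.Analysis.Complex.FlatTubeFourierDecay
import Mathlib.Analysis.SpecialFunctions.ImproperIntegrals
import Mathlib.MeasureTheory.Integral.Pi
import HarnessLib

/-!
# The flat tube theorem by Fourier transform, II: Fourier synthesis of the functional

Analysis/Complex support file (everything proved; no definitions, no named facts), sequel of
`FlatTubeFourierDecay`. For a functional `T` on `k`-tuples of functions `ℝ → ℂ` with Gaussian
window `e^{-bs²}` and slot representations (see the module docstring of `FlatTubeFourierDecay`),
this file identifies `T` on windowed Schwartz tuples with the integral of its Gaussian-windowed
Fourier data `Φ(p) = T(ψ_{p_1}, …, ψ_{p_k})`, `ψ_q(s) = e^{-bs²} e^{-2πiqs}`, against the inverse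
Fourier transforms of the entries:

  `T(e^{-b·²} ϑ₁, …, e^{-b·²} ϑ_k) = ∫_{ℝᵏ} Φ(p) ∏ⱼ (𝓕⁻ϑⱼ)(pⱼ) dp`

(`apply_gaussian_mul_eq_integral_fourierData`). Proof by induction on `k`: through the slot-`0`
representation `T(ϑ[0 ↦ ·]) = ∫ g(s) e^{-bs²} (·)(s) ds` and the self-adjointness of the Fourier
transform on `L¹` (`∫ f · 𝓕h = ∫ 𝓕f · h`, Mathlib's
`VectorFourier.integral_fourierIntegral_smul_eq_flip`) one has
`T(e^{-b·²}ϑ₀, …) = ∫ T(ψ_q, e^{-b·²}ϑ₁, …) (𝓕⁻ϑ₀)(q) dq`; the functional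
`θ ↦ T(ψ_q, θ)` of `k` slots inherits the slot representations, and the induction hypothesis
together with Fubini over `ℝ × ℝᵏ ≅ ℝ^{k+1}` finishes. The integrability of
`p ↦ Φ(p) ∏ (𝓕⁻ϑⱼ)(pⱼ)` comes from the polynomial bound `‖Φ(p)‖ ≤ C (1 + ‖p‖)ᴺ`
(`norm_fourierData_le_pow`) and the rapid decay of the Schwartz functions `𝓕⁻ϑⱼ`; its
measurability from the continuity of `Φ` (`continuous_apply_gaussMod`).

## References

* H. Epstein, in: *Axiomatic Field Theory* (Brandeis 1965), Gordon and Breach 1966 (the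
  Malgrange–Zerner theorem).
* K. Osterwalder, R. Schrader, Comm. Math. Phys. 42 (1975), §V.1 p. 292.
  [OsterwalderSchraderCMP1975]

Everything here is elementary and tagged folklore.
-/

noncomputable section

open _root_.Complex Set MeasureTheory Filter Real SchwartzMap Literature.Analysis.FunctionSpaces
open scoped _root_.Topology FourierTransform

namespace Literature.Analysis.Complex

variable {k : ℕ} {a b κ : ℝ}

/-! ### One-dimensional tools -/

/-- **Self-adjointness of the Fourier transform on `L¹(ℝ)`**: `∫ 𝓕f · h = ∫ f · 𝓕h` for
integrable `f, h` (Mathlib's `VectorFourier.integral_fourierIntegral_smul_eq_flip` on `ℝ`). [folklore] -/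
theorem integral_fourier_mul_eq_of_integrable {f h : ℝ → ℂ} (hf : Integrable f) (hh : Integrable h) :
    ∫ ξ : ℝ, 𝓕 f ξ * h ξ = ∫ x : ℝ, f x * 𝓕 h x := by
  simpa using! VectorFourier.integral_fourierIntegral_smul_eq_flip (L := innerₗ ℝ)
    Real.continuous_fourierChar continuous_inner hf hh

/-- **Polynomial decay of a Schwartz function on `ℝ`**: `‖φ x‖ ≤ D (1 + |x|)^{-m}`, written
multiplicatively. [folklore] -/
theorem exists_one_add_abs_pow_mul_norm_le (φ : 𝓢(ℝ, ℂ)) (m : ℕ) :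
    ∃ D : ℝ, 0 ≤ D ∧ ∀ x : ℝ, (1 + |x|) ^ m * ‖φ x‖ ≤ D := by
  refine ⟨2 ^ m * (Finset.Iic (m, 0)).sup (fun m => SchwartzMap.seminorm ℂ m.1 m.2) φ,
    by positivity, fun x => ?_⟩
  have h := SchwartzMap.one_add_le_sup_seminorm_apply (𝕜 := ℂ) (m := (m, 0)) le_rfl le_rfl φ x
  simpa [norm_iteratedFDeriv_zero] using h

/-- `x ↦ (1 + |x|)^{-2}` is integrable on `ℝ` (comparison with `(1 + x²)⁻¹`). [folklore] -/
theorem integrable_one_add_abs_pow_neg_two :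
    Integrable fun x : ℝ => ((1 + |x|) ^ 2)⁻¹ := by
  refine integrable_inv_one_add_sq.mono' (by fun_prop) (Eventually.of_forall fun x => ?_)
  rw [Real.norm_eq_abs, abs_of_pos (by positivity)]
  refine inv_anti₀ (by positivity) ?_
  nlinarith [abs_nonneg x, sq_abs x]

/-! ### The sup norm against the product of the coordinates -/

/-- `1 + ‖p‖ ≤ ∏ⱼ (1 + |pⱼ|)` for the sup norm on `ℝᵏ`. [folklore] -/
theorem one_add_norm_le_prod_one_add_abs (p : Fin k → ℝ) : 1 + ‖p‖ ≤ ∏ j, (1 + |p j|) := by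
  rcases isEmpty_or_nonempty (Fin k) with hk | hk
  · simp [Subsingleton.elim p 0]
  · obtain ⟨i, hi⟩ := exists_norm_eq_abs_apply p
    rw [hi]
    calc 1 + |p i| = ∏ j, (if j = i then 1 + |p i| else 1) := by
          rw [Finset.prod_ite_eq']; simp
      _ ≤ ∏ j, (1 + |p j|) := by
          refine Finset.prod_le_prod (fun j _ => by split_ifs <;> positivity) fun j _ => ?_
          split_ifs with h
          · rw [h]
          · linarith [abs_nonneg (p j)]

/-- `(1 + ‖p‖)ᴺ ≤ ∏ⱼ (1 + |pⱼ|)ᴺ`. [folklore] -/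
theorem one_add_norm_pow_le_prod (p : Fin k → ℝ) (N : ℕ) : (1 + ‖p‖) ^ N ≤ ∏ j, (1 + |p j|) ^ N := by
  rw [Finset.prod_pow]
  exact pow_le_pow_left₀ (by positivity) (one_add_norm_le_prod_one_add_abs p) N

/-! ### Integrability of the windowed Fourier data against Schwartz factors -/

/-- **A continuous function on `ℝᵏ` of polynomial growth times a product of Schwartz functions of
the coordinates is integrable.** [folklore] -/
theorem integrable_mul_prod_schwartz {Φ : (Fin k → ℝ) → ℂ} (hΦ : Continuous Φ) {C : ℝ} {N : ℕ}
    (hC : ∀ p, ‖Φ p‖ ≤ C * (1 + ‖p‖) ^ N) (h : Fin k → 𝓢(ℝ, ℂ)) :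
    Integrable fun p : Fin k → ℝ => Φ p * ∏ j, h j (p j) := by
  -- Schwartz decay with exponent `N + 2` for each factor
  choose D hD0 hD using fun j => exists_one_add_abs_pow_mul_norm_le (h j) (N + 2)
  have hint : Integrable fun p : Fin k → ℝ => ∏ j, (D j * ((1 + |p j|) ^ 2)⁻¹) :=
    Integrable.fintype_prod (f := fun j (x : ℝ) => D j * ((1 + |x|) ^ 2)⁻¹)
      fun j => integrable_one_add_abs_pow_neg_two.const_mul (D j)
  refine (hint.const_mul |C|).mono' ?_ (Eventually.of_forall fun p => ?_)
  · exact (hΦ.mul (continuous_finsetProd _ fun j _ =>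
      ((h j).continuous.comp (continuous_apply j)))).aestronglyMeasurable
  rw [norm_mul, norm_prod]
  have hC' : ‖Φ p‖ ≤ |C| * ∏ j, (1 + |p j|) ^ N :=
    (hC p).trans ((mul_le_mul_of_nonneg_right (le_abs_self C) (by positivity)).trans
      (mul_le_mul_of_nonneg_left (one_add_norm_pow_le_prod p N) (abs_nonneg C)))
  have hfac : ∀ j, (1 + |p j|) ^ N * ‖h j (p j)‖ ≤ D j * ((1 + |p j|) ^ 2)⁻¹ := by
    intro j
    have h1 := hD j (p j)
    rw [pow_add, mul_assoc] at h1
    rw [← div_eq_mul_inv, le_div_iff₀ (by positivity)]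
    linarith
  calc ‖Φ p‖ * ∏ j, ‖h j (p j)‖ ≤ (|C| * ∏ j, (1 + |p j|) ^ N) * ∏ j, ‖h j (p j)‖ := by
        gcongr
    _ = |C| * ∏ j, ((1 + |p j|) ^ N * ‖h j (p j)‖) := by rw [Finset.prod_mul_distrib]; ring
    _ ≤ |C| * ∏ j, (D j * ((1 + |p j|) ^ 2)⁻¹) :=
        mul_le_mul_of_nonneg_left
          (Finset.prod_le_prod (fun j _ => by positivity) fun j _ => hfac j) (abs_nonneg C)

/-! ### The polynomial bound on the windowed Fourier data -/

/-- Through a slot representation on the real line, `‖Φ(p)‖ ≤ M ∫ e^{κ|x| - 2bx²} dx`. [folklore] -/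
theorem norm_apply_gaussMod_le_of_slot_real (hb : 0 < b) {T : (Fin k → ℝ → ℂ) → ℂ}
    {p : Fin k → ℝ} {i : Fin k} {g : ℂ → ℂ} {M : ℝ}
    (hM : ∀ x : ℝ, ‖g x‖ ≤ M * Real.exp (κ * |x|))
    (hrep : ∀ ϑ : 𝓢(ℝ, ℂ), T (Function.update
        (fun j (s : ℝ) => Complex.exp (-(b : ℂ) * (s : ℂ) ^ 2) * Complex.exp (↑(-2 * π * s * p j) * I))
        i ϑ) = ∫ s : ℝ, g s * Complex.exp (-(b : ℂ) * (s : ℂ) ^ 2) * ϑ s) :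
    ‖T (fun j (s : ℝ) => Complex.exp (-(b : ℂ) * (s : ℂ) ^ 2) * Complex.exp (↑(-2 * π * s * p j) * I))‖ ≤
      M * ∫ x : ℝ, Real.exp (κ * |x| - 2 * b * x ^ 2) := by
  obtain ⟨φ, hφ⟩ := exists_schwartzMap_gaussMod hb (p i)
  have hupd : Function.update
      (fun j (s : ℝ) => Complex.exp (-(b : ℂ) * (s : ℂ) ^ 2) * Complex.exp (↑(-2 * π * s * p j) * I))
      i (φ : ℝ → ℂ) =
      fun j (s : ℝ) => Complex.exp (-(b : ℂ) * (s : ℂ) ^ 2) * Complex.exp (↑(-2 * π * s * p j) * I) := by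
    have : (φ : ℝ → ℂ) = fun s : ℝ =>
        Complex.exp (-(b : ℂ) * (s : ℂ) ^ 2) * Complex.exp (↑(-2 * π * s * p i) * I) := funext hφ
    rw [this]
    exact Function.update_eq_self i _
  rw [← hupd, hrep φ]
  have hM0 : 0 ≤ M := nonneg_of_norm_le_mul_exp hM
  have hpt : ∀ s : ℝ, ‖g s * Complex.exp (-(b : ℂ) * (s : ℂ) ^ 2) * φ s‖ ≤
      M * Real.exp (κ * |s| - 2 * b * s ^ 2) := by
    intro s
    rw [hφ, norm_mul, norm_mul, norm_mul, Complex.norm_exp, Complex.norm_exp]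
    have h1 : (-(b : ℂ) * (s : ℂ) ^ 2).re = -b * s ^ 2 := by
      simp only [sq, neg_mul, neg_re, mul_re, mul_im, ofReal_re, ofReal_im, mul_zero, sub_zero,
        zero_mul, add_zero]
    have h2 : ((↑(-2 * π * s * p i) : ℂ) * I).re = 0 := by simp
    rw [h1, h2, Real.exp_zero, mul_one]
    calc ‖g s‖ * Real.exp (-b * s ^ 2) * Real.exp (-b * s ^ 2)
        ≤ M * Real.exp (κ * |s|) * Real.exp (-b * s ^ 2) * Real.exp (-b * s ^ 2) := by
          gcongr; exact hM s
      _ = M * Real.exp (κ * |s| - 2 * b * s ^ 2) := by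
          rw [show κ * |s| - 2 * b * s ^ 2 = κ * |s| + -b * s ^ 2 + -b * s ^ 2 by ring,
            Real.exp_add, Real.exp_add]; ring
  refine (norm_integral_le_of_norm_le ((integrable_exp_mul_abs_sub_mul_sq
    (by positivity : 0 < 2 * b) κ).const_mul M) (Eventually.of_forall hpt)).trans ?_
  rw [integral_const_mul]

/-- **Polynomial bound on the windowed Fourier data**: if at every tuple of modulated Gaussians
some slot (here: every slot) is represented with the real-line bound `C (1 + ‖p‖)ᴺ e^{κ|x|}`,
then `‖Φ(p)‖ ≤ C' (1 + ‖p‖)ᴺ`. (For `k = 0` the data is constant.) [folklore] -/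
theorem norm_fourierData_le_pow (hb : 0 < b) {T : (Fin k → ℝ → ℂ) → ℂ} {C : ℝ} {N : ℕ}
    (hslot : ∀ (p : Fin k → ℝ) (i : Fin k), ∃ g : ℂ → ℂ, ContinuousOn g {z : ℂ | |z.im| < a} ∧
      (∀ x : ℝ, ‖g x‖ ≤ C * (1 + ‖p‖) ^ N * Real.exp (κ * |x|)) ∧
      ∀ ϑ : 𝓢(ℝ, ℂ), T (Function.update
        (fun j (s : ℝ) => Complex.exp (-(b : ℂ) * (s : ℂ) ^ 2) * Complex.exp (↑(-2 * π * s * p j) * I))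
        i ϑ) = ∫ s : ℝ, g s * Complex.exp (-(b : ℂ) * (s : ℂ) ^ 2) * ϑ s) :
    ∃ C' : ℝ, ∀ p : Fin k → ℝ,
      ‖T (fun j (s : ℝ) => Complex.exp (-(b : ℂ) * (s : ℂ) ^ 2) *
        Complex.exp (↑(-2 * π * s * p j) * I))‖ ≤ C' * (1 + ‖p‖) ^ N := by
  rcases isEmpty_or_nonempty (Fin k) with hk | hk
  · -- no slots: all tuples coincide
    refine ⟨‖T (fun j (s : ℝ) => 0)‖, fun p => ?_⟩
    have : (fun j (s : ℝ) => Complex.exp (-(b : ℂ) * (s : ℂ) ^ 2) *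
        Complex.exp (↑(-2 * π * s * p j) * I)) = fun j (s : ℝ) => 0 := Subsingleton.elim _ _
    rw [this]
    exact le_mul_of_one_le_right (norm_nonneg _) (one_le_pow₀ (by linarith [norm_nonneg p]))
  · obtain ⟨i⟩ := hk
    refine ⟨C * ∫ x : ℝ, Real.exp (κ * |x| - 2 * b * x ^ 2), fun p => ?_⟩
    obtain ⟨g, -, hM, hrep⟩ := hslot p i
    calc _ ≤ C * (1 + ‖p‖) ^ N * ∫ x : ℝ, Real.exp (κ * |x| - 2 * b * x ^ 2) :=
          norm_apply_gaussMod_le_of_slot_real hb hM hrep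
      _ = _ := by ring

/-! ### The Fourier synthesis -/

/-- The window times a Schwartz function is (the coercion of) a Schwartz function. [folklore] -/
theorem exists_schwartzMap_gaussian_mul (hb : 0 < b) (ϑ : 𝓢(ℝ, ℂ)) :
    ∃ θ : 𝓢(ℝ, ℂ), ∀ s : ℝ, θ s = Complex.exp (-(b : ℂ) * (s : ℂ) ^ 2) * ϑ s := by
  refine ⟨SchwartzMap.smulLeftCLM ℂ (⇑(gaussianSchwartz ℝ b)) ϑ, fun s => ?_⟩
  rw [SchwartzMap.smulLeftCLM_apply_apply (gaussianSchwartz ℝ b).hasTemperateGrowth,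
    gaussianSchwartz_apply hb, smul_eq_mul, Complex.ofReal_exp]
  congr 2
  rw [Real.norm_eq_abs, sq_abs]
  push_cast
  ring

/-- **Fourier synthesis of the functional.** Let `T` be a functional on `k`-tuples of functions
`ℝ → ℂ` such that (i) for every slot `i` and every tuple `θ` of Schwartz functions there is `g`
continuous on the strip `{|Im z| < a}` with a real-line bound `‖g(x)‖ ≤ M e^{κ|x|}` representing the
slot, `T(θ[i ↦ ϑ]) = ∫ g(s) e^{-bs²} ϑ(s) ds` for all Schwartz `ϑ`, and (ii) at tuples of modulated
Gaussians `ψ_{p_j}` the bound is polynomial, `M ≤ C (1 + ‖p‖)ᴺ`. Then for all Schwartz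
`ϑ₁, …, ϑ_k`,

  `T(e^{-b·²}ϑ₁, …, e^{-b·²}ϑ_k) = ∫_{ℝᵏ} T(ψ_{p_1}, …, ψ_{p_k}) ∏ⱼ (𝓕⁻ϑⱼ)(pⱼ) dp`.

Induction on `k` (module docstring). [folklore] -/
theorem apply_gaussian_mul_eq_integral_fourierData (hb : 0 < b) (ha : 0 < a) :
    ∀ (k : ℕ) (T : (Fin k → ℝ → ℂ) → ℂ),
    (∀ (i : Fin k) (θ : Fin k → 𝓢(ℝ, ℂ)), ∃ g : ℂ → ℂ, ContinuousOn g {z : ℂ | |z.im| < a} ∧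
      (∃ M : ℝ, ∀ x : ℝ, ‖g x‖ ≤ M * Real.exp (κ * |x|)) ∧
      ∀ ϑ : 𝓢(ℝ, ℂ), T (Function.update (fun j => ⇑(θ j)) i ϑ) =
        ∫ s : ℝ, g s * Complex.exp (-(b : ℂ) * (s : ℂ) ^ 2) * ϑ s) →
    (∃ (C : ℝ) (N : ℕ), ∀ (p : Fin k → ℝ) (i : Fin k), ∃ g : ℂ → ℂ,
      ContinuousOn g {z : ℂ | |z.im| < a} ∧
      (∀ x : ℝ, ‖g x‖ ≤ C * (1 + ‖p‖) ^ N * Real.exp (κ * |x|)) ∧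
      ∀ ϑ : 𝓢(ℝ, ℂ), T (Function.update
        (fun j (s : ℝ) => Complex.exp (-(b : ℂ) * (s : ℂ) ^ 2) * Complex.exp (↑(-2 * π * s * p j) * I))
        i ϑ) = ∫ s : ℝ, g s * Complex.exp (-(b : ℂ) * (s : ℂ) ^ 2) * ϑ s) →
    ∀ ϑ : Fin k → 𝓢(ℝ, ℂ),
      T (fun j (s : ℝ) => Complex.exp (-(b : ℂ) * (s : ℂ) ^ 2) * ϑ j s) =
        ∫ p : Fin k → ℝ, T (fun j (s : ℝ) => Complex.exp (-(b : ℂ) * (s : ℂ) ^ 2) *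
          Complex.exp (↑(-2 * π * s * p j) * I)) * ∏ j, (𝓕⁻ (ϑ j) : 𝓢(ℝ, ℂ)) (p j) := by
  intro k
  induction k with
  | zero =>
      intro T _ _ ϑ
      have hconst : ∀ p : Fin 0 → ℝ, (fun j (s : ℝ) => Complex.exp (-(b : ℂ) * (s : ℂ) ^ 2) *
          Complex.exp (↑(-2 * π * s * p j) * I)) =
          fun j (s : ℝ) => Complex.exp (-(b : ℂ) * (s : ℂ) ^ 2) * ϑ j s := fun p =>
        Subsingleton.elim _ _
      simp only [hconst, Finset.univ_eq_empty, Finset.prod_empty, mul_one, integral_const]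
      have hvol : (volume : Measure (Fin 0 → ℝ)) Set.univ = 1 := by
        rw [volume_pi, ← Set.pi_univ, Measure.pi_pi]; simp
      simp [Measure.real, hvol]
  | succ k ih =>
      intro T hT hB ϑ
      obtain ⟨C, N, hB⟩ := hB
      -- the windowed tuple as a Schwartz tuple
      choose θ hθ using fun j => exists_schwartzMap_gaussian_mul hb (ϑ j)
      have hθfun : (fun j => ⇑(θ j)) = fun j (s : ℝ) => Complex.exp (-(b : ℂ) * (s : ℂ) ^ 2) * ϑ j s :=
        funext fun j => funext (hθ j)
      -- slot `0` at the Schwartz tuple `θ`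
      obtain ⟨g, hg, ⟨M, hM⟩, hrep⟩ := hT 0 θ
      rw [hθfun] at hrep
      have hgc : Continuous fun s : ℝ => g s :=
        hg.comp_continuous Complex.continuous_ofReal fun s => by simpa using ha
      -- (1) `T(wϑ) = ∫ (g w²) ϑ₀`
      have h1 : T (fun j (s : ℝ) => Complex.exp (-(b : ℂ) * (s : ℂ) ^ 2) * ϑ j s) =
          ∫ s : ℝ, (g s * Complex.exp (-((2 * b : ℝ) : ℂ) * (s : ℂ) ^ 2)) * ϑ 0 s := by
        have hupd : Function.update (fun j (s : ℝ) => Complex.exp (-(b : ℂ) * (s : ℂ) ^ 2) * ϑ j s)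
            0 (θ 0 : ℝ → ℂ) = fun j (s : ℝ) => Complex.exp (-(b : ℂ) * (s : ℂ) ^ 2) * ϑ j s := by
          rw [← hθfun]; exact Function.update_eq_self 0 _
        rw [← hupd, hrep (θ 0)]
        refine integral_congr_ae (Eventually.of_forall fun s => ?_)
        simp only [hθ 0 s]
        rw [show g s * Complex.exp (-(b : ℂ) * (s : ℂ) ^ 2) *
            (Complex.exp (-(b : ℂ) * (s : ℂ) ^ 2) * ϑ 0 s) =
            g s * (Complex.exp (-(b : ℂ) * (s : ℂ) ^ 2) * Complex.exp (-(b : ℂ) * (s : ℂ) ^ 2)) * ϑ 0 s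
            by ring, ← Complex.exp_add]
        congr 3
        push_cast; ring
      -- (2) the slot-`0` Fourier transform is the data at `(ψ_q, wϑ₁, …)`
      have h2 : ∀ q : ℝ, 𝓕 (fun s : ℝ => g s * Complex.exp (-((2 * b : ℝ) : ℂ) * (s : ℂ) ^ 2)) q =
          T (Function.update (fun j (s : ℝ) => Complex.exp (-(b : ℂ) * (s : ℂ) ^ 2) * ϑ j s) 0
            (fun s : ℝ => Complex.exp (-(b : ℂ) * (s : ℂ) ^ 2) *
              Complex.exp (↑(-2 * π * s * q) * I))) := by
        intro q
        obtain ⟨φ, hφ⟩ := exists_schwartzMap_gaussMod hb q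
        have : (fun s : ℝ => Complex.exp (-(b : ℂ) * (s : ℂ) ^ 2) *
            Complex.exp (↑(-2 * π * s * q) * I)) = (φ : ℝ → ℂ) := (funext hφ).symm
        rw [this, hrep φ, Real.fourier_real_eq_integral_exp_smul]
        refine integral_congr_ae (Eventually.of_forall fun s => ?_)
        simp only [hφ, smul_eq_mul]
        rw [show g s * Complex.exp (-(b : ℂ) * (s : ℂ) ^ 2) * (Complex.exp (-(b : ℂ) * (s : ℂ) ^ 2) *
            Complex.exp (↑(-2 * π * s * q) * I)) = g s * (Complex.exp (-(b : ℂ) * (s : ℂ) ^ 2) *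
            (Complex.exp (-(b : ℂ) * (s : ℂ) ^ 2) * Complex.exp (↑(-2 * π * s * q) * I))) by ring,
          gaussian_mul_gaussMod]
        ring
      -- (3) duality: `∫ (g w²) ϑ₀ = ∫ 𝓕(g w²) 𝓕⁻ϑ₀`
      have hint_gw : Integrable fun s : ℝ => g s * Complex.exp (-((2 * b : ℝ) : ℂ) * (s : ℂ) ^ 2) := by
        have h := integrable_mul_gaussian_mul (by positivity : 0 < 2 * b) ha hg hM
          continuous_const (fun s => le_refl ‖(1 : ℂ)‖)
        refine h.congr (Eventually.of_forall fun s => ?_)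
        push_cast
        ring
      have h3 : (∫ s : ℝ, (g s * Complex.exp (-((2 * b : ℝ) : ℂ) * (s : ℂ) ^ 2)) * ϑ 0 s) =
          ∫ q : ℝ, 𝓕 (fun s : ℝ => g s * Complex.exp (-((2 * b : ℝ) : ℂ) * (s : ℂ) ^ 2)) q *
            (𝓕⁻ (ϑ 0) : 𝓢(ℝ, ℂ)) q := by
        have hinv : ∀ s : ℝ, ϑ 0 s = 𝓕 ((𝓕⁻ (ϑ 0) : 𝓢(ℝ, ℂ)) : ℝ → ℂ) s := fun s => by
          rw [← SchwartzMap.fourier_coe, FourierTransform.fourier_fourierInv_eq]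
        simp_rw [hinv]
        exact (integral_fourier_mul_eq_of_integrable hint_gw (𝓕⁻ (ϑ 0) : 𝓢(ℝ, ℂ)).integrable).symm
      -- (4) the `k`-slot functional `θ' ↦ T(ψ_q, θ')` and the induction hypothesis
      have h4 : ∀ q : ℝ, T (Function.update (fun j (s : ℝ) =>
          Complex.exp (-(b : ℂ) * (s : ℂ) ^ 2) * ϑ j s) 0
            (fun s : ℝ => Complex.exp (-(b : ℂ) * (s : ℂ) ^ 2) * Complex.exp (↑(-2 * π * s * q) * I))) =
          ∫ p' : Fin k → ℝ, T (Fin.cons (fun s : ℝ => Complex.exp (-(b : ℂ) * (s : ℂ) ^ 2) *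
              Complex.exp (↑(-2 * π * s * q) * I))
            (fun j (s : ℝ) => Complex.exp (-(b : ℂ) * (s : ℂ) ^ 2) *
              Complex.exp (↑(-2 * π * s * p' j) * I))) *
            ∏ j, (𝓕⁻ (ϑ (Fin.succ j)) : 𝓢(ℝ, ℂ)) (p' j) := by
        intro q
        obtain ⟨φq, hφq⟩ := exists_schwartzMap_gaussMod hb q
        set ψq : ℝ → ℂ := fun s : ℝ => Complex.exp (-(b : ℂ) * (s : ℂ) ^ 2) *
          Complex.exp (↑(-2 * π * s * q) * I) with hψq
        have hφqfun : (φq : ℝ → ℂ) = ψq := funext hφq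
        set Tq : (Fin k → ℝ → ℂ) → ℂ := fun θ' => T (Fin.cons ψq θ') with hTq
        -- the update at slot 0 is a cons
        have hcons : Function.update (fun j (s : ℝ) => Complex.exp (-(b : ℂ) * (s : ℂ) ^ 2) * ϑ j s)
            0 ψq = Fin.cons ψq (fun j (s : ℝ) => Complex.exp (-(b : ℂ) * (s : ℂ) ^ 2) * ϑ (Fin.succ j) s) := by
          rw [← Fin.cons_self_tail (fun j (s : ℝ) => Complex.exp (-(b : ℂ) * (s : ℂ) ^ 2) * ϑ j s),
            Fin.update_cons_zero]
          rfl
        rw [hcons]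
        change Tq _ = ∫ p' : Fin k → ℝ, Tq _ * _
        -- hypotheses for `Tq`
        refine ih Tq (fun i θ' => ?_) ⟨C * (1 + |q|) ^ N, N, fun p' i => ?_⟩ fun j => ϑ (Fin.succ j)
        · obtain ⟨g', hg', hM', hrep'⟩ := hT (Fin.succ i) (Fin.cons φq θ')
          refine ⟨g', hg', hM', fun ϑ' => ?_⟩
          have := hrep' ϑ'
          rw [show (fun j => ⇑(Fin.cons (α := fun _ => 𝓢(ℝ, ℂ)) φq θ' j)) =
              Fin.cons (α := fun _ => ℝ → ℂ) (φq : ℝ → ℂ) (fun j => ⇑(θ' j)) by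
                funext j; refine Fin.cases ?_ (fun i => ?_) j <;> simp,
            ← Fin.cons_update, hφqfun] at this
          exact this
        · obtain ⟨g', hg', hM', hrep'⟩ := hB (Fin.cons q p') (Fin.succ i)
          have hnorm : ‖Fin.cons (α := fun _ => ℝ) q p'‖ ≤ |q| + ‖p'‖ := by
            refine (pi_norm_le_iff_of_nonneg (by positivity)).2 fun j => ?_
            refine Fin.cases ?_ (fun i => ?_) j
            · simp
            · simpa using (norm_le_pi_norm p' i).trans (le_add_of_nonneg_left (abs_nonneg q))
          have hC : 0 ≤ C :=
            le_of_mul_le_mul_right (by simpa using nonneg_of_norm_le_mul_exp hM')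
              (by positivity : (0 : ℝ) < (1 + ‖Fin.cons (α := fun _ => ℝ) q p'‖) ^ N)
          have hpow : (1 + ‖Fin.cons (α := fun _ => ℝ) q p'‖) ^ N ≤ (1 + |q|) ^ N * (1 + ‖p'‖) ^ N := by
            rw [← mul_pow]
            exact pow_le_pow_left₀ (by positivity)
              (by nlinarith [norm_nonneg p', abs_nonneg q, hnorm]) N
          refine ⟨g', hg', fun x => (hM' x).trans ?_, fun ϑ' => ?_⟩
          · calc C * (1 + ‖Fin.cons (α := fun _ => ℝ) q p'‖) ^ N * Real.exp (κ * |x|)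
                ≤ C * ((1 + |q|) ^ N * (1 + ‖p'‖) ^ N) * Real.exp (κ * |x|) := by gcongr
              _ = C * (1 + |q|) ^ N * (1 + ‖p'‖) ^ N * Real.exp (κ * |x|) := by ring
          · have := hrep' ϑ'
            rw [show (fun j (s : ℝ) => Complex.exp (-(b : ℂ) * (s : ℂ) ^ 2) *
                Complex.exp (↑(-2 * π * s * Fin.cons (α := fun _ => ℝ) q p' j) * I)) =
                Fin.cons (α := fun _ => ℝ → ℂ) ψq (fun j (s : ℝ) => Complex.exp (-(b : ℂ) * (s : ℂ) ^ 2) *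
                  Complex.exp (↑(-2 * π * s * p' j) * I)) by
                  funext j; refine Fin.cases ?_ (fun i => ?_) j <;> simp [hψq],
              ← Fin.cons_update] at this
            exact this
      -- (5) assemble with Fubini over `ℝ × ℝᵏ ≅ ℝ^{k+1}`
      rw [h1, h3]
      simp_rw [h2, h4]
      -- integrability of the full integrand on `ℝ^{k+1}`
      have hΦc : Continuous fun p : Fin (k + 1) → ℝ => T (fun j (s : ℝ) =>
          Complex.exp (-(b : ℂ) * (s : ℂ) ^ 2) * Complex.exp (↑(-2 * π * s * p j) * I)) :=
        continuous_apply_gaussMod hb ha hB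
      obtain ⟨C', hC'⟩ := norm_fourierData_le_pow hb hB
      have hG := integrable_mul_prod_schwartz hΦc hC' fun j => (𝓕⁻ (ϑ j) : 𝓢(ℝ, ℂ))
      -- rewrite the right-hand side through `piFinSuccAbove`
      symm
      rw [volume_pi, ← ((measurePreserving_piFinSuccAbove (fun _ : Fin (k + 1) => (volume : Measure ℝ))
        0).symm).integral_comp']
      simp only [MeasurableEquiv.piFinSuccAbove_symm_apply, Fin.insertNthEquiv, Equiv.coe_fn_mk,
        Fin.insertNth_zero', Fin.prod_univ_succ, Fin.cons_zero, Fin.cons_succ]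
      have hG' : Integrable (fun z : ℝ × (Fin k → ℝ) =>
          T (fun j (s : ℝ) => Complex.exp (-(b : ℂ) * (s : ℂ) ^ 2) *
            Complex.exp (↑(-2 * π * s * Fin.cons (α := fun _ => ℝ) z.1 z.2 j) * I)) *
          ((𝓕⁻ (ϑ 0) : 𝓢(ℝ, ℂ)) z.1 * ∏ j : Fin k, (𝓕⁻ (ϑ (Fin.succ j)) : 𝓢(ℝ, ℂ)) (z.2 j)))
          ((volume : Measure ℝ).prod (Measure.pi fun _ : Fin k => (volume : Measure ℝ))) := by
        have h := ((measurePreserving_piFinSuccAbove (fun _ : Fin (k + 1) => (volume : Measure ℝ))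
          0).symm).integrable_comp_emb (MeasurableEquiv.measurableEmbedding _) |>.2
          (by rw [← volume_pi]; exact hG)
        refine h.congr (Eventually.of_forall fun z => ?_)
        simp only [Function.comp_apply, MeasurableEquiv.piFinSuccAbove_symm_apply, Fin.insertNthEquiv,
          Equiv.coe_fn_mk, Fin.insertNth_zero', Fin.prod_univ_succ, Fin.cons_zero, Fin.cons_succ]
      rw [integral_prod _ hG']
      refine integral_congr_ae (Eventually.of_forall fun q => ?_)
      simp only
      rw [← integral_mul_const]
      refine integral_congr_ae (Eventually.of_forall fun p' => ?_)
      beta_reduce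
      have : (fun j (s : ℝ) => Complex.exp (-(b : ℂ) * (s : ℂ) ^ 2) *
          Complex.exp (↑(-2 * π * s * Fin.cons (α := fun _ => ℝ) q p' j) * I)) =
          Fin.cons (α := fun _ => ℝ → ℂ) (fun s : ℝ => Complex.exp (-(b : ℂ) * (s : ℂ) ^ 2) *
            Complex.exp (↑(-2 * π * s * q) * I))
          (fun j (s : ℝ) => Complex.exp (-(b : ℂ) * (s : ℂ) ^ 2) *
            Complex.exp (↑(-2 * π * s * p' j) * I)) := by
        funext j; refine Fin.cases ?_ (fun i => ?_) j <;> simp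
      rw [this]
      ring

end Literature.Analysis.Complex
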